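import Literature.Probability.RandomPlanarGeometry.SLERestrictionHitFinal
import Literature.Probability.RandomPlanarGeometry.SmoothHitPathExists
import Literature.Probability.RandomPlanarGeometry.AccessArc
import HarnessLib

/-!
# [LSW] Lemma 6.3 reduced to the sector claim

With the access facts discharged (`IsSmoothHullWith.exists_smoothHitPath_holds`,
`SmoothHitPathExists`; `IsArcHull.exists_accessArc_holds`, `AccessArc`) and the limit
`IsSmoothHull.hitPath_tendsto_holds` (`SLERestrictionHitPathTendsto`), the analytic proof of
[LSW] Lemma 6.3 in this tree (`SLERestrictionHitFinal`) depends on exactly one named fact: the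
sector claim `IsSmoothHull.hitPath_stolz` of [LSW]'s proof of Lemma 6.3 ("`β̂(x)` lies in a
sector `|Re z| ≤ c Im z`", proved in print by a two-sided harmonic-measure estimate for Brownian
motion stopped on `K_T ∪ ℝ` and conformal invariance).

* `restrictionDerivVanishesAtHit_of_stolz` — `IsSmoothHull.hitPath_stolz →
  IsSmoothHull.restrictionDerivVanishesAtHit`.
-/

noncomputable section

namespace Literature.Probability.RandomPlanarGeometry

/-- **[LSW] Lemma 6.3 from the sector claim alone**: the named fact
`IsSmoothHull.restrictionDerivVanishesAtHit` follows from `IsSmoothHull.hitPath_stolz`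
(everything else in the analytic proof is proved in the tree).
[cite: LawlerSchrammWerner2003Restriction, Lemma 6.3 and its proof (sector claim)] -/
theorem restrictionDerivVanishesAtHit_of_stolz (h : IsSmoothHull.hitPath_stolz) :
    IsSmoothHull.restrictionDerivVanishesAtHit :=
  restrictionDerivVanishesAtHit_of_stolz_access h IsSmoothHullWith.exists_smoothHitPath_holds
    IsArcHull.exists_accessArc_holds

end Literature.Probability.RandomPlanarGeometry
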